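import Mathlib
import Literature.NumberTheory.Transcendental.SemialgebraicMapsProofs
import Literature.NumberTheory.Transcendental.KZUnfoldedStokes
import Summits.KontsevichZagierPeriods.KontsevichZagierPeriods.Theorems.ScissorsTransportPolytopeTransportDet
import Summits.KontsevichZagierPeriods.KontsevichZagierPeriods.Theorems.ScissorsTransportPolytopeTransportPoly

/-!
# Polytope transport — cylindrical cells with polynomial bounds

Helper file for `PolytopeTransport` (stmt-KontsevichZagierPeriods-10815, route ScissorsTransport).
A *cell datum* in dimension `n` (`CellData n`) is, recursively, a cell datum `c` in dimension
`n - 1` together with two `ℚ`-polynomials `a, b` in the tail variables; its set is the open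
cylindrical cell `{x | tail x ∈ c.set, a (tail x) < x 0 < b (tail x)}` (first coordinate
distinguished). `wfSet` (well-formedness) asks `a < b` on the base cell, recursively. We record that
cell sets are open, `ℚ`-semialgebraic and non-empty, define the *total weight* `TW c w` of a
polynomial weight `w` on a cell (the iterated definite integral, a rational number computed purely
algebraically through `defInt`) and prove its positivity; the unit cube is `KZ.unitCube`.
All folklore (cylindrical cells as in Bochnak–Coste–Roy 1998, §2.3, with polynomial sections).
-/

noncomputable section

open Set MvPolynomial
open Literature.NumberTheory.Transcendental
open Literature.NumberTheory.Transcendental.KZ (unitCube mem_unitCube isOpen_unitCube)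
open Literature.ModelTheory.ExponentialFields (IsSemialgebraic isSemialgebraic_univ
  isSemialgebraic_setOf_eval_lt)

namespace Summit.KontsevichZagierPeriods.ScissorsTransport.PolytopeTransport

/-- Cell data: polynomial lower/upper bounds for each coordinate in terms of the later ones.
[folklore] -/
inductive CellData : ℕ → Type
  /-- the one-point cell `ℝ⁰` -/
  | nil : CellData 0
  /-- the cell `{x | tail x ∈ c, a (tail x) < x 0 < b (tail x)}` over `c` -/
  | cons {n : ℕ} (a b : MvPolynomial (Fin n) ℚ) (c : CellData n) : CellData (n + 1)

namespace CellData

variable {n : ℕ}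

/-- The open cylindrical cell described by a cell datum. [folklore] -/
def set : {n : ℕ} → CellData n → Set (Fin n → ℝ)
  | _, nil => univ
  | _, cons a b c => {x | Fin.tail x ∈ c.set ∧ aeval (Fin.tail x) a < x 0 ∧ x 0 < aeval (Fin.tail x) b}

/-- The well-formed cell data (`wfSet n ⊆ CellData n`): every fibre of every level is a non-empty
interval (`a < b` on the base cell, recursively). [folklore] -/
def wfSet : (n : ℕ) → Set (CellData n)
  | 0 => univ
  | n + 1 => {c | ∃ (a b : MvPolynomial (Fin n) ℚ) (c' : CellData n), c = cons a b c' ∧ c' ∈ wfSet n ∧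
      ∀ y ∈ c'.set, aeval y a < aeval y b}

/-- The total weight of a polynomial weight `w` on a cell: the iterated definite integral
`∫_cell w`, computed formally (`defInt`) down to dimension `0`; a rational number. [folklore] -/
def TW : {n : ℕ} → CellData n → MvPolynomial (Fin n) ℚ → ℚ
  | _, nil, w => aeval (Fin.elim0 : Fin 0 → ℚ) w
  | _, cons a b c, w => c.TW (defInt w a b)

/-- The cell of `nil` is the one-point space. [folklore] -/
@[simp] theorem set_nil : (nil).set = univ := rfl

/-- Membership in the cell of `cons a b c`. [folklore] -/
theorem mem_set_cons {a b : MvPolynomial (Fin n) ℚ} {c : CellData n} {x : Fin (n + 1) → ℝ} :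
    x ∈ (cons a b c).set ↔
      Fin.tail x ∈ c.set ∧ aeval (Fin.tail x) a < x 0 ∧ x 0 < aeval (Fin.tail x) b := Iff.rfl

/-- Membership of `(t, y)` in the cell of `cons a b c`. [folklore] -/
theorem cons_mem_set_cons {a b : MvPolynomial (Fin n) ℚ} {c : CellData n} {t : ℝ} {y : Fin n → ℝ} :
    (Fin.cons t y : Fin (n + 1) → ℝ) ∈ (cons a b c).set ↔ y ∈ c.set ∧ aeval y a < t ∧ t < aeval y b := by
  simp [mem_set_cons]

/-- `nil` is well-formed. [folklore] -/
@[simp] theorem nil_mem_wfSet : nil ∈ wfSet 0 := trivial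

/-- `cons a b c` is well-formed iff `c` is and `a < b` on the cell of `c`. [folklore] -/
theorem cons_mem_wfSet {a b : MvPolynomial (Fin n) ℚ} {c : CellData n} :
    cons a b c ∈ wfSet (n + 1) ↔ c ∈ wfSet n ∧ ∀ y ∈ c.set, aeval y a < aeval y b := by
  constructor
  · rintro ⟨a', b', c', h, h1, h2⟩
    simp only [cons.injEq] at h
    obtain ⟨rfl, rfl, rfl⟩ := h
    exact ⟨h1, h2⟩
  · exact fun h => ⟨a, b, c, rfl, h.1, h.2⟩

/-- Total weight in dimension `0`: the value of the (constant) weight. [folklore] -/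
@[simp] theorem TW_nil (w : MvPolynomial (Fin 0) ℚ) : (nil).TW w = aeval (Fin.elim0 : Fin 0 → ℚ) w := rfl

/-- In dimension `0`, real evaluation of a `ℚ`-polynomial is its rational value. [folklore] -/
theorem aeval_fin_zero (x : Fin 0 → ℝ) (w : MvPolynomial (Fin 0) ℚ) :
    aeval x w = ((aeval (Fin.elim0 : Fin 0 → ℚ) w : ℚ) : ℝ) := by
  have h : (aeval x : MvPolynomial (Fin 0) ℚ →ₐ[ℚ] ℝ) =
      (Algebra.ofId ℚ ℝ).comp (aeval (Fin.elim0 : Fin 0 → ℚ)) :=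
    MvPolynomial.algHom_ext fun i => Fin.elim0 i
  have := congrArg (fun φ => φ w) h
  simpa using this

/-- Total weight of `cons a b c`: integrate out the first variable. [folklore] -/
@[simp] theorem TW_cons (a b : MvPolynomial (Fin n) ℚ) (c : CellData n) (w : MvPolynomial (Fin (n + 1)) ℚ) :
    (cons a b c).TW w = c.TW (defInt w a b) := rfl

/-- Cell sets are open. [folklore] -/
theorem isOpen_set : ∀ {n : ℕ} (c : CellData n), IsOpen c.set
  | _, nil => isOpen_univ
  | _, @cons m a b c => by
    have ht : Continuous (fun x : Fin (m + 1) → ℝ => Fin.tail x) :=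
      continuous_pi fun i => continuous_apply i.succ
    refine ((isOpen_set c).preimage ht).inter (IsOpen.inter ?_ ?_)
    · exact isOpen_lt ((continuous_aeval a).comp ht) (continuous_apply 0)
    · exact isOpen_lt (continuous_apply 0) ((continuous_aeval b).comp ht)

/-- Cell sets are `ℚ`-semialgebraic. [folklore] -/
theorem isSemialgebraic_set : ∀ {n : ℕ} (c : CellData n), IsSemialgebraic ℚ c.set
  | _, nil => isSemialgebraic_univ
  | _, @cons m a b c => by
    have h1 : IsSemialgebraic ℚ {x : Fin (m + 1) → ℝ | Fin.tail x ∈ c.set} :=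
      (isSemialgebraic_set c).preimage_comp Fin.succ
    have h2 := isSemialgebraic_setOf_eval_lt (k := ℚ) (R := ℝ) (liftPoly a) (X (0 : Fin (m + 1)))
    have h3 := isSemialgebraic_setOf_eval_lt (k := ℚ) (R := ℝ) (X (0 : Fin (m + 1))) (liftPoly b)
    convert h1.inter (h2.inter h3) using 1
    ext x
    simp [mem_set_cons]

/-- Well-formed cells are non-empty. [folklore] -/
theorem nonempty_set : ∀ {n : ℕ} (c : CellData n), c ∈ wfSet n → c.set.Nonempty
  | _, nil, _ => ⟨Fin.elim0, trivial⟩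
  | _, cons a b c, h => by
    obtain ⟨y, hy⟩ := nonempty_set c (cons_mem_wfSet.1 h).1
    refine ⟨Fin.cons ((aeval y a + aeval y b) / 2) y, ?_⟩
    rw [cons_mem_set_cons]
    have := (cons_mem_wfSet.1 h).2 y hy
    exact ⟨hy, by linarith, by linarith⟩

/-- Positivity of the weight on a cell passes to the integrated weight on the base cell.
[folklore] -/
theorem defInt_pos_of_pos {a b : MvPolynomial (Fin n) ℚ} {c : CellData n}
    (h : cons a b c ∈ wfSet (n + 1))
    {w : MvPolynomial (Fin (n + 1)) ℚ} (hw : ∀ x ∈ (cons a b c).set, 0 < aeval x w) :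
    ∀ y ∈ c.set, 0 < aeval y (defInt w a b) := fun y hy =>
  defInt_pos w a b y ((cons_mem_wfSet.1 h).2 y hy) fun t ht =>
    hw (Fin.cons t y) (cons_mem_set_cons.2 ⟨hy, ht.1, ht.2⟩)

/-- The total weight of a positive weight on a well-formed cell is positive. [folklore] -/
theorem TW_pos : ∀ {n : ℕ} (c : CellData n), c ∈ wfSet n → ∀ (w : MvPolynomial (Fin n) ℚ),
    (∀ x ∈ c.set, 0 < aeval x w) → 0 < (c.TW w : ℝ)
  | _, nil, _, w, hw => by
    have h := hw Fin.elim0 trivial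
    rwa [aeval_fin_zero] at h
  | _, cons _ _ c, h, _, hw => TW_pos c (cons_mem_wfSet.1 h).1 _ (defInt_pos_of_pos h hw)

end CellData

/-! The open unit cube `(0, 1)ⁿ` is `KZ.unitCube` (file `KZUnfoldedStokes`). -/

/-- The unit cube in dimension `0` is the point. [folklore] -/
theorem unitCube_zero : unitCube 0 = univ := by
  ext x
  simp

/-- Membership of `(t, y)` in the unit cube. [folklore] -/
theorem cons_mem_unitCube {n : ℕ} {t : ℝ} {y : Fin n → ℝ} :
    (Fin.cons t y : Fin (n + 1) → ℝ) ∈ unitCube (n + 1) ↔ t ∈ Ioo (0 : ℝ) 1 ∧ y ∈ unitCube n := by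
  simp only [mem_unitCube, Fin.forall_fin_succ, Fin.cons_zero, Fin.cons_succ]

/-- Membership in the unit cube, first coordinate split off. [folklore] -/
theorem mem_unitCube_succ {n : ℕ} {x : Fin (n + 1) → ℝ} :
    x ∈ unitCube (n + 1) ↔ x 0 ∈ Ioo (0 : ℝ) 1 ∧ Fin.tail x ∈ unitCube n := by
  conv_lhs => rw [← Fin.cons_self_tail x]
  exact cons_mem_unitCube

end Summit.KontsevichZagierPeriods.ScissorsTransport.PolytopeTransport

/-!
# Polytope transport — every well-formed cell is a weighted image of the unit cube

Helper file for `PolytopeTransport` (stmt-KontsevichZagierPeriods-10815, route ScissorsTransport).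
**Main result** (`exists_cellMap`): for a well-formed cell datum `c` in dimension `n` and a
`ℚ`-polynomial weight `w > 0` on `c.set`, there is a `ℚ`-semialgebraic map `G`, strictly
differentiable and injective on `c.set`, with `G '' c.set = (0,1)ⁿ` exactly and Jacobian
determinant `det DG(x) = w(x) / TW c w`. Construction by recursion on the dimension (first
coordinate distinguished): `G(t, y) = (∫_{a y}^{t} w(s, y) ds / H(y), G'(y))` where
`H = defInt w a b` is the fibre integral (a polynomial weight on the base cell) and `G'` is the map
of the base cell for the weight `H`; the Jacobian is block triangular (`det_consCLM`). For `w = 1`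
this is a volume-normalised "Knothe–Rosenblatt" straightening of the cell, entirely inside the
`ℚ`-semialgebraic category because all fibre integrals of polynomials between polynomial bounds are
polynomials. Folklore calculus.
-/

noncomputable section

open Set MvPolynomial
open Literature.NumberTheory.Transcendental
open Literature.NumberTheory.Transcendental.KZ (unitCube mem_unitCube)
open Literature.ModelTheory.ExponentialFields (IsSemialgebraic isSemialgebraic_univ)

namespace Summit.KontsevichZagierPeriods.ScissorsTransport.PolytopeTransport

variable {n : ℕ}

/-- The coordinate line `s ↦ (s, y)` has velocity `e₀`. [folklore] -/
theorem hasDerivAt_cons_line (y : Fin n → ℝ) (s : ℝ) :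
    HasDerivAt (fun s : ℝ => (Fin.cons s y : Fin (n + 1) → ℝ)) (Pi.single 0 1) s := by
  rw [hasDerivAt_pi]
  intro i
  refine Fin.cases ?_ (fun j => ?_) i
  · simp only [Fin.cons_zero, Pi.single_eq_same]
    exact hasDerivAt_id' s
  · have h0 : (Pi.single (0 : Fin (n + 1)) (1 : ℝ) : Fin (n + 1) → ℝ) j.succ = 0 :=
      Pi.single_eq_of_ne (Fin.succ_ne_zero j) _
    simpa [h0] using hasDerivAt_const s (y j)

/-- The entry `ℓ e₀` of a derivative `ℓ` of `u` at `x` is the derivative of `u` along the first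
coordinate line through `x`. [folklore] -/
theorem apply_single_eq_of_hasDerivAt {u : (Fin (n + 1) → ℝ) → ℝ} {ℓ : (Fin (n + 1) → ℝ) →L[ℝ] ℝ}
    {x : Fin (n + 1) → ℝ} (hu : HasFDerivAt u ℓ x) {e : ℝ}
    (he : HasDerivAt (fun s : ℝ => u (Fin.cons s (Fin.tail x) : Fin (n + 1) → ℝ)) e (x 0)) :
    ℓ (Pi.single 0 1) = e := by
  have hu' : HasFDerivAt u ℓ (Fin.cons (x 0) (Fin.tail x) : Fin (n + 1) → ℝ) := by
    rwa [Fin.cons_self_tail]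
  have h := hu'.comp_hasDerivAt (x 0) (hasDerivAt_cons_line (Fin.tail x) (x 0))
  exact h.unique he

/-- A quotient of polynomial functions `p(x) / H(tail x)` is strictly differentiable where the
denominator does not vanish. [folklore] -/
theorem hasStrictFDerivAt_aeval_div (p : MvPolynomial (Fin (n + 1)) ℚ) (H : MvPolynomial (Fin n) ℚ)
    {x : Fin (n + 1) → ℝ} (hx : aeval (Fin.tail x) H ≠ 0) :
    HasStrictFDerivAt (fun x : Fin (n + 1) → ℝ => aeval x p / aeval (Fin.tail x) H)
      (fderiv ℝ (fun x : Fin (n + 1) → ℝ => aeval x p / aeval (Fin.tail x) H) x) x := by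
  have h1 : ContDiffAt ℝ 1 (fun x : Fin (n + 1) → ℝ => aeval x p) x := (contDiff_aeval p).contDiffAt
  have h2 : ContDiffAt ℝ 1 (fun x : Fin (n + 1) → ℝ => aeval (Fin.tail x) H) x := by
    have := contDiff_aeval (m := 1) (liftPoly H)
    simp only [aeval_liftPoly] at this
    exact this.contDiffAt
  exact (h1.div h2 hx).hasStrictFDerivAt one_ne_zero

/-- The tail map is `ℚ`-semialgebraic on every `ℚ`-semialgebraic set. [folklore] -/
theorem isSemialgebraicMapOn_tail {s : Set (Fin (n + 1) → ℝ)} (hs : IsSemialgebraic ℚ s) :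
    IsSemialgebraicMapOn ℚ s (fun x : Fin (n + 1) → ℝ => Fin.tail x) := by
  convert isSemialgebraicMapOn_aeval hs (fun j : Fin n => (X j.succ : MvPolynomial (Fin (n + 1)) ℚ))
    using 2 with x
  ext j
  simp [Fin.tail]

/-- A quotient `p(x) / H(tail x)` with non-vanishing denominator is a `ℚ`-semialgebraic function.
[folklore] -/
theorem isSemialgebraicFunOn_aeval_div_tail {s : Set (Fin (n + 1) → ℝ)} (hs : IsSemialgebraic ℚ s)
    (p : MvPolynomial (Fin (n + 1)) ℚ) (H : MvPolynomial (Fin n) ℚ)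
    (hH : ∀ x ∈ s, aeval (Fin.tail x) H ≠ 0) :
    IsSemialgebraicFunOn ℚ s (fun x : Fin (n + 1) → ℝ => aeval x p / aeval (Fin.tail x) H) := by
  have h := isSemialgebraicFunOn_aeval_div_aeval hs p (liftPoly H)
    (fun x hx => by rw [aeval_liftPoly]; exact hH x hx)
  exact h.congr fun x _ => by simp

open CellData in
/-- **Cells are weighted images of the unit cube.** For a well-formed cell datum `c` and a
polynomial weight `w > 0` on `c.set` there is a `ℚ`-semialgebraic `G`, strictly differentiable and
injective on `c.set`, with `G '' c.set = (0,1)ⁿ` and `det DG = w / TW c w` on `c.set`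
(`TW c w ∈ ℚ` the total weight).
[folklore] -/
theorem exists_cellMap : ∀ {n : ℕ} (c : CellData n), c ∈ wfSet n → ∀ (w : MvPolynomial (Fin n) ℚ),
    (∀ x ∈ c.set, 0 < aeval x w) →
    ∃ (G : (Fin n → ℝ) → (Fin n → ℝ)) (D : (Fin n → ℝ) → (Fin n → ℝ) →L[ℝ] (Fin n → ℝ)),
      IsSemialgebraicMapOn ℚ c.set G ∧ (∀ x ∈ c.set, HasStrictFDerivAt G (D x) x) ∧
      (∀ x ∈ c.set, (D x).det = aeval x w / (c.TW w : ℝ)) ∧ InjOn G c.set ∧ G '' c.set = unitCube n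
  | _, nil, _, w, hw => by
    refine ⟨id, fun _ => ContinuousLinearMap.id ℝ _, ?_, ?_, ?_, injOn_id _, ?_⟩
    · simpa using isSemialgebraicMapOn_id (k := ℚ) (isSemialgebraic_univ (ι := Fin 0) (R := ℝ))
    · intro x _
      exact hasStrictFDerivAt_id x
    · intro x _
      have hpos := hw x trivial
      rw [TW_nil, ← aeval_fin_zero x, div_self hpos.ne']
      show LinearMap.det ((ContinuousLinearMap.id ℝ (Fin 0 → ℝ) : (Fin 0 → ℝ) →L[ℝ] (Fin 0 → ℝ)) :
        (Fin 0 → ℝ) →ₗ[ℝ] (Fin 0 → ℝ)) = 1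
      rw [ContinuousLinearMap.coe_id, LinearMap.det_id]
    · simp [unitCube_zero]
  | _, @cons m a b c, hWF, w, hw => by
    -- the integrated weight on the base cell and the base map
    set H : MvPolynomial (Fin m) ℚ := defInt w a b with hH_def
    have hHpos : ∀ y ∈ c.set, 0 < aeval y H := defInt_pos_of_pos hWF hw
    have hWF' := cons_mem_wfSet.1 hWF
    obtain ⟨G', D', hsa', hder', hdet', hinj', himg'⟩ := exists_cellMap c hWF'.1 H hHpos
    -- the new first coordinate and the map
    set u : (Fin (m + 1) → ℝ) → ℝ := fun x => aeval x (primZero w a) / aeval (Fin.tail x) H with hu_def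
    set G : (Fin (m + 1) → ℝ) → (Fin (m + 1) → ℝ) := fun x => Fin.cons (u x) (G' (Fin.tail x)) with hG_def
    set D : (Fin (m + 1) → ℝ) → (Fin (m + 1) → ℝ) →L[ℝ] (Fin (m + 1) → ℝ) :=
      fun x => consCLM (fderiv ℝ u x) (D' (Fin.tail x)) with hD_def
    have hCsa : IsSemialgebraic ℚ (cons a b c).set := isSemialgebraic_set _
    -- fibrewise facts
    have hfib : ∀ x ∈ (cons a b c).set, Fin.tail x ∈ c.set ∧
        aeval (Fin.tail x) a < aeval (Fin.tail x) b ∧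
        (∀ t ∈ Ioo (aeval (Fin.tail x) a) (aeval (Fin.tail x) b),
          0 < aeval (Fin.cons t (Fin.tail x) : Fin (m + 1) → ℝ) w) ∧
        x 0 ∈ Ioo (aeval (Fin.tail x) a) (aeval (Fin.tail x) b) := by
      intro x hx
      rw [mem_set_cons] at hx
      refine ⟨hx.1, hx.2.1.trans hx.2.2, fun t ht => hw _ (cons_mem_set_cons.2 ⟨hx.1, ht.1, ht.2⟩),
        hx.2.1, hx.2.2⟩
    refine ⟨G, D, ?_, ?_, ?_, ?_, ?_⟩
    · -- semialgebraic
      refine IsSemialgebraicMapOn.of_forall hCsa fun j => ?_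
      refine Fin.cases ?_ (fun i => ?_) j
      · have h := isSemialgebraicFunOn_aeval_div_tail hCsa (primZero w a) H
          (fun x hx => (hHpos _ (hfib x hx).1).ne')
        exact h.congr fun x _ => by simp [hG_def, hu_def]
      · have hst : MapsTo (fun x : Fin (m + 1) → ℝ => Fin.tail x) (cons a b c).set c.set :=
          fun x hx => (hfib x hx).1
        have hgi : IsSemialgebraicFunOn ℚ c.set (fun y => G' y i) :=
          (isSemialgebraicMapOn_iff_forall_holds (isSemialgebraic_set c)).1 hsa' i
        have h := IsSemialgebraicFunOn.comp_isSemialgebraicMapOn_holds hgi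
          (isSemialgebraicMapOn_tail hCsa) hst
        exact h.congr fun x _ => by simp [hG_def]
    · -- strict derivative
      intro x hx
      have hx' := hfib x hx
      exact hasStrictFDerivAt_cons (hasStrictFDerivAt_aeval_div (primZero w a) H (hHpos _ hx'.1).ne')
        (hder' _ hx'.1)
    · -- determinant
      intro x hx
      obtain ⟨hy, hab, hwfib, hx0⟩ := hfib x hx
      have hHy : aeval (Fin.tail x) H ≠ 0 := (hHpos _ hy).ne'
      have hline : HasDerivAt (fun s : ℝ => u (Fin.cons s (Fin.tail x) : Fin (m + 1) → ℝ))
          (aeval x w / aeval (Fin.tail x) H) (x 0) := by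
        have h := (hasDerivAt_aeval_primZero w a (Fin.tail x) (x 0)).div_const (aeval (Fin.tail x) H)
        simp only [Fin.cons_self_tail] at h
        have hfun : (fun s : ℝ => u (Fin.cons s (Fin.tail x) : Fin (m + 1) → ℝ)) = fun s =>
            aeval (Fin.cons s (Fin.tail x) : Fin (m + 1) → ℝ) (primZero w a) / aeval (Fin.tail x) H := by
          funext s
          simp [hu_def]
        rw [hfun]
        exact h
      have h0 : fderiv ℝ u x (Pi.single 0 1) = aeval x w / aeval (Fin.tail x) H :=
        apply_single_eq_of_hasDerivAt
          (hasStrictFDerivAt_aeval_div (primZero w a) H hHy).hasFDerivAt hline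
      have hTW : (c.TW H : ℝ) ≠ 0 := (TW_pos c hWF'.1 H hHpos).ne'
      rw [hD_def, det_consCLM, h0, hdet' _ hy, TW_cons, ← hH_def]
      field_simp
    · -- injectivity
      intro x₁ hx₁ x₂ hx₂ hEq
      obtain ⟨hy₁, hab₁, hw₁, hx0₁⟩ := hfib x₁ hx₁
      obtain ⟨hy₂, -, -, hx0₂⟩ := hfib x₂ hx₂
      have htail : Fin.tail x₁ = Fin.tail x₂ := by
        refine hinj' hy₁ hy₂ ?_
        have := congrArg Fin.tail hEq
        simpa [hG_def] using this
      have hH1 : aeval (Fin.tail x₁) H ≠ 0 := (hHpos _ hy₁).ne'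
      have hu12 : u x₁ = u x₂ := by
        have := congrFun hEq 0
        simpa [hG_def] using this
      have hprim : aeval x₁ (primZero w a) = aeval x₂ (primZero w a) := by
        simp only [hu_def, ← htail] at hu12
        exact (div_left_inj' hH1).1 hu12
      have h0 : x₁ 0 = x₂ 0 := by
        refine injOn_aeval_primZero w a b (Fin.tail x₁) hw₁ hx0₁ (htail ▸ hx0₂) ?_
        simp only
        rw [Fin.cons_self_tail, htail, Fin.cons_self_tail]
        exact hprim
      rw [← Fin.cons_self_tail x₁, ← Fin.cons_self_tail x₂, h0, htail]
    · -- image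
      apply Subset.antisymm
      · rintro _ ⟨x, hx, rfl⟩
        obtain ⟨hy, hab, hwfib, hx0⟩ := hfib x hx
        rw [hG_def]
        simp only [cons_mem_unitCube]
        refine ⟨?_, himg' ▸ mem_image_of_mem G' hy⟩
        have hmem := aeval_primZero_mem_Ioo w a b (Fin.tail x) hab hwfib hx0
        rw [Fin.cons_self_tail] at hmem
        have hHy := hHpos _ hy
        exact ⟨div_pos hmem.1 hHy, (div_lt_one hHy).2 hmem.2⟩
      · intro z hz
        rw [mem_unitCube_succ] at hz
        obtain ⟨hz0, hzt⟩ := hz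
        rw [← himg'] at hzt
        obtain ⟨y, hy, hyz⟩ := hzt
        have hab : aeval y a < aeval y b := hWF'.2 y hy
        have hHy := hHpos y hy
        have hv : z 0 * aeval y H ∈ Ioo 0 (aeval y (defInt w a b)) :=
          ⟨mul_pos hz0.1 hHy, by simpa [hH_def] using mul_lt_of_lt_one_left hHy hz0.2⟩
        obtain ⟨t, ht, htv⟩ := exists_aeval_primZero_eq w a b y hab hv
        refine ⟨Fin.cons t y, cons_mem_set_cons.2 ⟨hy, ht.1, ht.2⟩, ?_⟩
        rw [hG_def]
        simp only [Fin.tail_cons, hyz]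
        rw [← Fin.cons_self_tail z]
        congr 1
        simp only [hu_def, Fin.tail_cons, htv]
        field_simp

end Summit.KontsevichZagierPeriods.ScissorsTransport.PolytopeTransport
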